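import Summits.QuantumFields.YangMills.Theorems.InfiniteVolumeContinuumTemperedMomentBoundPieces
import HarnessLib

/-!
# Tempered E3 (stub E3T of leaf 19868), part 2/3 — one LARGE Whitney piece under tempered atom ceilings: the WEIGHTED
atomic series, slot-wise route atoms, tempered H4 per atom

Free-hands helper toward the registered stub E3T `stub_temperedMomentBoundA : WhitneyPkgW → AtomicSqrtDominationR →
TemperedMomentBoundA` of LINES «TemperedPeak» REV 2 / «OctaveDoubling» REV 2.1 on the leaf
`InfiniteVolumeContinuum.HypercubicOSDataFromInfiniteVolume` (stmt-QuantumFields-19868).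
Twin of E3's H5 `large_piece_bound` (`AtomicCalibrationRSmearedAtomicBound`): a large piece `Gp` (radius `ρ ≥ a`,
`ρ ≤ ½`) written as a WEIGHTED atomic series (`atomicSynthesisW`: `Σ_i |coef_i| ∏_l (ρ/σ_il)^M ≤ Mtot`) has lattice
moment `|Σ'_x M_n(x) Gp(z_x)| ≤ Mtot (ρ^M)⁻ⁿ (C n^θ √ε)ⁿ` under TMB-A's ceiling-form hypothesis at exponent `M`:
per atom the tempered H4 gives `(C n^θ √ε)ⁿ ∏_l (√(σ_il^M))⁻¹ ≤ (C n^θ √ε)ⁿ (ρ^M)⁻ⁿ ∏_l (ρ/σ_il)^M`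
(`σ ≤ ρ ≤ ½` so `σ^M ≤ √(σ^M)`), and the weighted mass sums it.  The interchange of the lattice sum with the atomic
series is the unweighted one of E3 (fixed `a`, finite carriers).

HONEST LABEL: helper lemma toward a registered side stub (E3T) of two DRAFT lines; 28168 enters as a HYPOTHESIS
(its clause); no crux / rung / leaf / summit is proved; YM mass gap NOT proved.
-/

set_option autoImplicit false
noncomputable section
open scoped BigOperators
open MeasureTheory Filter Topology
open Literature.MathematicalPhysics.QuantumFieldTheory Literature.MathematicalPhysics.QuantumLattice
open Literature.Probability.LatticeModels (Site)
open Summit.QuantumFields.YangMills.Cruxes.OSLegsFromFemtoAndGap.DlrCollarTransfer (plane exists_abs_plane_le)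
open Summit.QuantumFields.YangMills.Theorems.InfiniteVolume (stateMomentStr)
open Summit.QuantumFields.YangMills.Theorems.InfVolRP (centreOffset)
open Summit.QuantumFields.YangMills.Theses.OnsetTautology
open Summit.QuantumFields.YangMills.Cruxes.AtomicCalibrationR.MirrorCalibration

namespace Summit.QuantumFields.YangMills.Theorems.TemperedMomentBound

variable {G : Type} [Group G] [TopologicalSpace G] [IsTopologicalGroup G] [CompactSpace G]
  [MeasurableSpace G]

/-- For `0 < x ≤ 1`: `(√x)⁻¹ ≤ x⁻¹`. -/
theorem inv_sqrt_le_inv_of_le_one {x : ℝ} (hx : 0 < x) (hx1 : x ≤ 1) : (Real.sqrt x)⁻¹ ≤ x⁻¹ := by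
  have hxs : x ≤ Real.sqrt x := by
    have h1 : Real.sqrt x * Real.sqrt x = x := Real.mul_self_sqrt hx.le
    have h2 : Real.sqrt x ≤ 1 := by rw [← Real.sqrt_one]; exact Real.sqrt_le_sqrt hx1
    nlinarith [Real.sqrt_nonneg x]
  exact inv_anti₀ hx hxs

/-- The tempered per-atom loss in WEIGHT form: for sizes `0 < σ_l ≤ ρ ≤ ½`,
`∏_l (√(σ_l^M))⁻¹ ≤ (ρ^M)⁻ⁿ ∏_l (ρ/σ_l)^M`. -/
theorem prod_inv_sqrt_pow_le {n M : ℕ} {ρ : ℝ} (hρ : 0 < ρ) (hρh : ρ ≤ 1 / 2) (σ : Fin n → ℝ)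
    (hσ : ∀ l, 0 < σ l ∧ σ l ≤ ρ) :
    ∏ l, (Real.sqrt ((σ l) ^ M))⁻¹ ≤ ((ρ ^ M)⁻¹) ^ n * ∏ l, (ρ / σ l) ^ M := by
  have hterm : ∀ l, (Real.sqrt ((σ l) ^ M))⁻¹ ≤ (ρ ^ M)⁻¹ * (ρ / σ l) ^ M := by
    intro l
    have hσ1 : σ l ≤ 1 := (hσ l).2.trans (by linarith)
    have h1 : (Real.sqrt ((σ l) ^ M))⁻¹ ≤ ((σ l) ^ M)⁻¹ :=
      inv_sqrt_le_inv_of_le_one (pow_pos (hσ l).1 M) (pow_le_one₀ (hσ l).1.le hσ1)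
    refine h1.trans (le_of_eq ?_)
    have hσ0 : (σ l) ^ M ≠ 0 := pow_ne_zero _ (hσ l).1.ne'
    have hρ0 : ρ ^ M ≠ 0 := pow_ne_zero _ hρ.ne'
    rw [div_pow]
    field_simp
  calc ∏ l, (Real.sqrt ((σ l) ^ M))⁻¹ ≤ ∏ l, ((ρ ^ M)⁻¹ * (ρ / σ l) ^ M) :=
        Finset.prod_le_prod (fun l _ => inv_nonneg.2 (Real.sqrt_nonneg _)) fun l _ => hterm l
    _ = ((ρ ^ M)⁻¹) ^ n * ∏ l, (ρ / σ l) ^ M := by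
        rw [Finset.prod_mul_distrib, Finset.prod_const, Finset.card_univ, Fintype.card_fin]

/-- **Tempered H5 `large_piece_bound_tempered`.**  For a LARGE piece (`a ≤ ρ ≤ ½`, slots `Λρ`-separated with
`Λ ≥ 4t + 12`) written as a WEIGHTED absolutely convergent atomic series
`Gp = Σ_i coef_i ∏_l b(σ_il⁻¹ • (· − η_il))` with `Σ_i |coef_i| ∏_l (ρ/σ_il)^M ≤ Mtot`, under TMB-A's ceiling-form
hypothesis at exponent `M` and item 28168's clause, the lattice-smeared moment obeys
`|Σ'_x M_n(x) Gp(z_x)| ≤ Mtot · (ρ^M)⁻ⁿ · (C n^θ √ε)ⁿ`. -/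
theorem large_piece_bound_tempered (r : LatticeRep G) (C θ : ℝ) (μ : Measure (LGConfig 4 G))
    [IsProbabilityMeasure μ] (hC : 0 ≤ C) (h68 : SqrtDomClause r μ C θ)
    (b : SchwartzMap (EuclideanSpace ℝ (Fin 4)) ℝ) (t ε a ρ Λ : ℝ) (M : ℕ) (ht : 0 ≤ t)
    (hbt : ∀ u, b u ≠ 0 → ‖u‖ ≤ t) (hε : 0 < ε) (ha : 0 < a)
    (hT : ∀ (S : Finset ((Fin 4 × Fin 4) × (Fin 4 → ℤ))) (q : Fin 4 × Fin 4) (s t : ℝ) (y : EuclideanSpace ℝ (Fin 4))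
      (k : Fin 4) (c : ℤ), q.1 < q.2 → 0 < s → a < s → (∀ u, b u ≠ 0 → ‖u‖ ≤ t) →
      (∀ p, atomWt b {q} s y p ≠ 0 → p ∈ S) →
      ((∀ p ∈ S, ((p.2 k : ℤ) : ℝ) + t / s + 2 ≤ (c : ℝ)) ∨ (∀ p ∈ S, (c : ℝ) + t / s + 2 ≤ ((p.2 k : ℤ) : ℝ))) →
      ∑ p ∈ S, ∑ p' ∈ S, atomWt b {q} s y p * atomWt b {q} s y p' *
          stateMomentStr G r μ 2 ![p.1, p'.1] ![reflSite k c p, p'.2] ≤ ε * (s / a) ^ M)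
    (hρa : a ≤ ρ) (hρh : ρ ≤ 1 / 2) (hΛ : 4 * t + 12 ≤ Λ)
    {n : ℕ} (q : Fin n → Fin 4 × Fin 4) (c : Fin n → EuclideanSpace ℝ (Fin 4))
    (Gp : (Fin n → EuclideanSpace ℝ (Fin 4)) → ℝ) (coef : ℕ → ℝ) (σ : ℕ → Fin n → ℝ)
    (η : ℕ → Fin n → EuclideanSpace ℝ (Fin 4)) (Mtot : ℝ)
    (hn : 2 ≤ n) (hq : ∀ l, (q l).1 < (q l).2) (hsep : ∀ l l', l ≠ l' → ∃ k : Fin 4, Λ * ρ ≤ |c l k - c l' k|)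
    (hcoef : Summable (fun i => |coef i|)) (hcoefw : Summable (fun i => |coef i| * ∏ l, (ρ / σ i l) ^ M))
    (hMtot : ∑' i, |coef i| * ∏ l, (ρ / σ i l) ^ M ≤ Mtot)
    (hση : ∀ i l, 0 < σ i l ∧ σ i l ≤ ρ ∧ ‖η i l - c l‖ ≤ 2 * ρ)
    (hGp : ∀ z, Gp z = ∑' i, coef i * ∏ l, b ((σ i l)⁻¹ • (z l - η i l))) :
    |∑' x : Fin n → Site 4, stateMomentStr G r μ n q x *
        Gp (fun l => a • siteToE (x l) +
          (a / 2) • (EuclideanSpace.single (q l).1 (1 : ℝ) + EuclideanSpace.single (q l).2 (1 : ℝ)))| ≤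
      Mtot * ((ρ ^ M)⁻¹) ^ n * (C * n ^ θ * Real.sqrt ε) ^ n := by
  classical
  have hρ : 0 < ρ := lt_of_lt_of_le ha hρa
  obtain ⟨Cp, hCp⟩ := exists_abs_plane_le (G := G) r
  have hCp0 : 0 ≤ Cp := le_trans (abs_nonneg _) (hCp (0, 1) 0 (fun _ => 1))
  set B : ℝ := ‖b.toBoundedContinuousFunction‖ with hB
  have hB0 : 0 ≤ B := norm_nonneg _
  set D : ℝ := (C * n ^ θ * Real.sqrt ε) ^ n with hD
  have hD0 : 0 ≤ D := by positivity
  set Rw : ℝ := ((ρ ^ M)⁻¹) ^ n with hRw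
  have hRw0 : 0 ≤ Rw := by positivity
  -- weights (in the lattice sense) and carriers of the `i`-th tensor atom
  set w : ℕ → Fin n → (Fin 4 × Fin 4) × (Fin 4 → ℤ) → ℝ := fun i l =>
    atomWt b {q l} (a / σ i l) ((σ i l)⁻¹ • η i l) with hw
  set S : ℕ → Fin n → Finset ((Fin 4 × Fin 4) × (Fin 4 → ℤ)) := fun i l =>
    carrierFinset b (q l) (a / σ i l) t ((σ i l)⁻¹ • η i l) with hSdef
  have hs : ∀ i l, 0 < a / σ i l := fun i l => div_pos ha (hση i l).1
  have hS : ∀ i l p, w i l p ≠ 0 → p ∈ S i l := fun i l p h => (mem_carrierFinset hbt (hs i l)).2 h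
  have hSne : ∀ i l, ∀ p ∈ S i l, w i l p ≠ 0 := fun i l p h => (mem_carrierFinset hbt (hs i l)).1 h
  have hSq : ∀ i l, ∀ p ∈ S i l, p.1 = q l := fun i l p h => fst_eq_of_mem_carrierFinset h
  -- the per-atom synthesis weight
  set wt : ℕ → ℝ := fun i => ∏ l, (ρ / σ i l) ^ M with hwt
  have hwt0 : ∀ i, 0 ≤ wt i := fun i => Finset.prod_nonneg fun l _ => pow_nonneg (div_pos hρ (hση i l).1).le M
  -- the double family
  set f : ℕ → (Fin n → Site 4) → ℝ := fun i x =>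
    coef i * (stateMomentStr G r μ n q x * ∏ l, w i l (q l, x l)) with hf
  -- pointwise: `M(x) · Gp(z_x) = Σ'_i f i x`
  have hpt : ∀ x : Fin n → Site 4, stateMomentStr G r μ n q x *
      Gp (fun l => a • siteToE (x l) +
        (a / 2) • (EuclideanSpace.single (q l).1 (1 : ℝ) + EuclideanSpace.single (q l).2 (1 : ℝ))) =
      ∑' i, f i x := by
    intro x
    rw [hGp, ← tsum_mul_left]
    refine tsum_congr fun i => ?_
    have : ∏ l, b ((σ i l)⁻¹ • ((fun l => a • siteToE (x l) +
        (a / 2) • (EuclideanSpace.single (q l).1 (1 : ℝ) + EuclideanSpace.single (q l).2 (1 : ℝ))) l - η i l)) =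
        ∏ l, w i l (q l, x l) := by
      refine Finset.prod_congr rfl fun l _ => ?_
      show b ((σ i l)⁻¹ • (a • siteToE (x l) +
        (a / 2) • (EuclideanSpace.single (q l).1 (1 : ℝ) + EuclideanSpace.single (q l).2 (1 : ℝ)) - η i l)) =
        atomWt b {q l} (a / σ i l) ((σ i l)⁻¹ • η i l) (q l, x l)
      exact atom_sample b (hq l) a (σ i l) (η i l) (x l)
    rw [this, hf]
    ring
  -- per atom: the inner lattice sum is 28168's cluster sum, bounded by `D · Rw · wt i`
  have hAi : ∀ i, |∑' x : Fin n → Site 4, stateMomentStr G r μ n q x * ∏ l, w i l (q l, x l)| ≤ D * Rw * wt i := by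
    intro i
    rw [tensorAtom_tsum_eq_piFinset r μ q (w i) (S i) (hS i) (hSq i)]
    have h1 := tensorAtom_moment_le_tempered r C θ μ h68 b t ε a ρ Λ M ht hbt hε ha hT hρa hΛ q (σ i) (η i) c
      (S i) hn hq (fun l => ⟨(hση i l).1, (hση i l).2.1, by linarith [(hση i l).2.1]⟩) (fun l => (hση i l).2.2)
      hsep (hS i) (hSne i)
    refine h1.trans ?_
    calc _ ≤ D * (Rw * wt i) :=
          mul_le_mul_of_nonneg_left (prod_inv_sqrt_pow_le hρ hρh (σ i) (fun l => ⟨(hση i l).1, (hση i l).2.1⟩)) hD0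
      _ = D * Rw * wt i := (mul_assoc _ _ _).symm
  -- summability of `|f|` on `ℕ × configurations` (fixed `a`: finite carriers of uniformly bounded size)
  set Kc : ℝ := ((2 * (t * ρ) / a + 4) ^ 4) ^ n with hKc
  have hfin : ∀ i, ∀ x ∉ Fintype.piFinset (fun l => (S i l).image Prod.snd), f i x = 0 := fun i x hx => by
    rw [hf]
    show coef i * (stateMomentStr G r μ n q x * ∏ l, w i l (q l, x l)) = 0
    rw [prod_weight_eq_zero_of_not_mem q (w i) (S i) (hS i) hx, mul_zero, mul_zero]
  have hfi : ∀ i x, |f i x| ≤ |coef i| * ((Cp + Cp) ^ n * B ^ n) := by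
    intro i x
    rw [hf]
    show |coef i * (stateMomentStr G r μ n q x * ∏ l, w i l (q l, x l))| ≤ _
    rw [abs_mul, abs_mul, Finset.abs_prod]
    refine mul_le_mul_of_nonneg_left ?_ (abs_nonneg _)
    refine mul_le_mul
      (Summit.QuantumFields.YangMills.Theorems.InfiniteVolume.abs_stateMomentStr_le r μ hCp q x) ?_
      (Finset.prod_nonneg fun l _ => abs_nonneg _) (by positivity)
    calc ∏ l, |w i l (q l, x l)| ≤ ∏ _l : Fin n, B :=
          Finset.prod_le_prod (fun l _ => abs_nonneg _) (fun l _ => abs_atomWt_le_norm b _ _ _ _)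
      _ = B ^ n := by rw [Finset.prod_const, Finset.card_univ, Fintype.card_fin]
  have hcardT : ∀ i, ((Fintype.piFinset (fun l => (S i l).image Prod.snd)).card : ℝ) ≤ Kc := by
    intro i
    rw [Fintype.card_piFinset]
    push_cast
    have hslot : ∀ l, (((S i l).image Prod.snd).card : ℝ) ≤ (2 * (t * ρ) / a + 4) ^ 4 := fun l =>
      calc (((S i l).image Prod.snd).card : ℝ) ≤ ((S i l).card : ℝ) := by exact_mod_cast Finset.card_image_le
        _ ≤ (2 * t / (a / σ i l) + 4) ^ 4 := card_carrierFinset_le b (q l) (hs i l) ht _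
        _ ≤ (2 * (t * ρ) / a + 4) ^ 4 := by
            have e : 2 * t / (a / σ i l) = 2 * (t * σ i l) / a := by
              rw [div_div_eq_mul_div]; ring
            rw [e]
            have h0 : 0 ≤ 2 * (t * σ i l) / a + 4 := by
              have := (hση i l).1
              positivity
            have h1 : 2 * (t * σ i l) / a + 4 ≤ 2 * (t * ρ) / a + 4 := by
              gcongr
              exact (hση i l).2.1
            exact pow_le_pow_left₀ h0 h1 4
    calc ∏ l, (((S i l).image Prod.snd).card : ℝ) ≤ ∏ _l : Fin n, (2 * (t * ρ) / a + 4) ^ 4 :=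
          Finset.prod_le_prod (fun l _ => by positivity) (fun l _ => hslot l)
      _ = Kc := by rw [Finset.prod_const, Finset.card_univ, Fintype.card_fin]
  have hinner : ∀ i, Summable (fun x => |f i x|) := fun i =>
    summable_of_ne_finset_zero (s := Fintype.piFinset (fun l => (S i l).image Prod.snd))
      (fun x hx => by rw [hfin i x hx, abs_zero])
  have hinner_le : ∀ i, ∑' x, |f i x| ≤ |coef i| * ((Cp + Cp) ^ n * B ^ n * Kc) := by
    intro i
    rw [tsum_eq_sum (s := Fintype.piFinset (fun l => (S i l).image Prod.snd))
      (fun x hx => by rw [hfin i x hx, abs_zero])]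
    calc ∑ x ∈ Fintype.piFinset (fun l => (S i l).image Prod.snd), |f i x|
        ≤ ∑ _x ∈ Fintype.piFinset (fun l => (S i l).image Prod.snd), |coef i| * ((Cp + Cp) ^ n * B ^ n) :=
          Finset.sum_le_sum fun x _ => hfi i x
      _ = (Fintype.piFinset (fun l => (S i l).image Prod.snd)).card * (|coef i| * ((Cp + Cp) ^ n * B ^ n)) := by
          rw [Finset.sum_const, nsmul_eq_mul]
      _ ≤ Kc * (|coef i| * ((Cp + Cp) ^ n * B ^ n)) :=
          mul_le_mul_of_nonneg_right (hcardT i) (by positivity)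
      _ = |coef i| * ((Cp + Cp) ^ n * B ^ n * Kc) := by ring
  have habs : Summable (fun ix : ℕ × (Fin n → Site 4) => |f ix.1 ix.2|) :=
    (summable_prod_of_nonneg (f := fun ix : ℕ × (Fin n → Site 4) => |f ix.1 ix.2|) (fun ix => abs_nonneg _)).2
      ⟨hinner, Summable.of_nonneg_of_le (fun i => tsum_nonneg fun x => abs_nonneg _) hinner_le
        (hcoef.mul_right _)⟩
  have hunc : Summable (Function.uncurry f) := (summable_abs_iff (f := Function.uncurry f)).1 habs
  -- interchange and conclude
  rw [tsum_congr hpt, hunc.tsum_comm]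
  have hrow : ∀ i, ∑' x, f i x = coef i * ∑' x, stateMomentStr G r μ n q x * ∏ l, w i l (q l, x l) := fun i => by
    rw [hf]
    exact tsum_mul_left
  simp_rw [hrow]
  have hsum2 : Summable fun i => |coef i| * wt i * (D * Rw) := (hcoefw.mul_right (D * Rw))
  have hle : ∀ i, ‖coef i * ∑' x, stateMomentStr G r μ n q x * ∏ l, w i l (q l, x l)‖ ≤
      |coef i| * wt i * (D * Rw) := fun i => by
    rw [Real.norm_eq_abs, abs_mul]
    calc |coef i| * |∑' x, stateMomentStr G r μ n q x * ∏ l, w i l (q l, x l)| ≤ |coef i| * (D * Rw * wt i) :=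
          mul_le_mul_of_nonneg_left (hAi i) (abs_nonneg _)
      _ = |coef i| * wt i * (D * Rw) := by ring
  calc |∑' i, coef i * ∑' x, stateMomentStr G r μ n q x * ∏ l, w i l (q l, x l)|
      ≤ ∑' i, |coef i| * wt i * (D * Rw) := by
        rw [← Real.norm_eq_abs]
        exact tsum_of_norm_bounded hsum2.hasSum hle
    _ = (∑' i, |coef i| * wt i) * (D * Rw) := tsum_mul_right
    _ ≤ Mtot * (D * Rw) := mul_le_mul_of_nonneg_right hMtot (mul_nonneg hD0 hRw0)
    _ = Mtot * Rw * D := by ring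

end Summit.QuantumFields.YangMills.Theorems.TemperedMomentBound

end
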